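import Summits.BirchSwinnertonDyer.BirchSwinnertonDyer.Theorems.ByReductionTypeAtTwoSupersingularFlatColemanClauses
import Summits.BirchSwinnertonDyer.BirchSwinnertonDyer.Theorems.ThetaPartnerAtTwoSignedControlAtTwoPlusCyclicOfHonda
import Summits.BirchSwinnertonDyer.Rank1Residual.Supersingular.SprungPollackConsistency
import HarnessLib

/-!
# Route `ThetaPartnerAtTwo` (TP2), crux K3 `SignedKatoDivisibilityUpToAtTwo` (item stmt-BirchSwinnertonDyer-20308),
# line `colemanrat` v3 — file 16: **`Ker Col♭ = Ann(E⁺_∞)` at `a_p = 0`** — Sprung's ♭ Coleman kernel (functional model,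
# explicit Honda clauses, the `bsd-2adic` cell's `p = 2` port) IS the annihilator of Kobayashi's trace-defined plus groups
# `E⁺(K_n·K_v)` (Def. 1.1, the local condition of K3's `signedSelmerInfty W κ 1`)

HONEST FRAMING (cell `bsd-wall`, width seat `bsd-wall-tp2-p2x-w2` g2): THEOREMS ONLY — no definition, no named fact, no
instance, no `sorry`; kernel algebra on the tree's transcription of Sprung's Coleman map; the Honda clauses are DISPLAYED
HYPOTHESES (the body of K4's stub `stub_plusHondaSystemTwo` / the `bsd-2adic` cell's «explicit Honda clauses»); nothing about
any curve is asserted; closes no item; BSD is NOT proved by any of this.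

## Why this file (the junction of three existing bodies of work)

(1) The tree transcribes Sprung's ♯/♭ Coleman map in the FUNCTIONAL model `H¹_Iw(T) = Hom(E(K_∞·K_v), ℤ_p)`
(`Sprung2012/ColemanMaps.lean`: `pairingSum`, `IsColemanPair`, `colemanKer`), and Sprung's ♭ local condition is «the exact
annihilator of `Ker Col♭`» (Def. 7.9), for which «no explicit trace-map description is known» in general (Open Problem 7.22).
(2) The `bsd-2adic` cell (crux 19097, `Theorems/ByReductionTypeAtTwoSupersingularFlat*.lean`, ns `SSFlatEC`) ported the ♭
machinery to EXPLICIT Honda clauses at every `p` (`SSFlatEC.exists_isColemanPair_of_trace`: every functional has a Coleman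
value; kernel closed, bidual, `(E♭_∞)_Γ = 0`, …). (3) K3 (`SignedKatoDivisibilityUpToAtTwo`) and K4 are stated with
KOBAYASHI's trace-defined groups `E^±` (Def. 1.1, `Kobayashi2003.signedLocalPointsOfEmb`), and the K4 seats proved CYC⁺
(`SignedEC.plusCyclic_even_of_honda`: `E⁺_{2j} = ℤ[Γ]·d_{2j} + p·E⁺_{2j}`) from a Honda system `d` on the `ℤ_p`-tower with
`Tr_{m+2/m+1} d_{m+2} = −d_m` (the `a_p = 0` shape, HONDA⁺@2). THIS FILE proves that at `a_p = 0` the two local theories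
MEET: **`Ker Col♭ = {z : z kills every E⁺(K_n·K_v)}`** — Kobayashi's Prop. 8.18–8.23 mechanism (the `±` Coleman maps are
dual to the `±` points) read on the functional model. (A) `⊇`: at `a_p = 0`, `u_n = 0` for even `n` and `v_n = 0` for odd `n`
(`sharpPoly_zero_of_even`, `flatPoly_zero_of_odd`), so `(L♯, 0)` is a Coleman value of `z` as soon as the EVEN pairing sums
`P_{n,d_n}(z) = ∑_j z(gʲd_n)(1+T)ʲ` vanish — and they do when `z` kills `E⁺_n ∋ gʲ d_n` (`d_{2j} ∈ E⁺_{2j}`, K4). (B) `⊆`: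
`Col♭(z) = 0` gives `ω_n ∣ P_{n,d_n}(z)` for even `n`; `ω_n` is DISTINGUISHED (`Kato2004.IwasawaH1Exists.isDistinguishedAt_omega`)
and `P_{n,d_n}(z)` is a polynomial of degree `< pⁿ`, so Weierstrass UNIQUENESS (Mathlib `IsWeierstrassDivisorAt.eq_zero_of_mul_eq`)
forces `P_{n,d_n}(z) = 0`, i.e. `z(gʲ d_n) = 0` for `j < pⁿ`; every `Γ_{K_v}`-conjugate of `d_n` is such a `gʲ d_n`; then CYC⁺
gives `z(E⁺_n) ⊆ p·z(E⁺_n)`, hence `z(E⁺_n) = 0` (`ℤ_p` is `p`-adically separated).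
CONSEQUENCE: at `p = 2`, `a₂ = 0`, the local condition of K3's `Sel⁺` (Kummer classes of `E⁺ ⊗ ℚ₂/ℤ₂`) lies inside Sprung's ♭
condition (annihilator of `Ker Col♭`) — the `19097` cell's Col♭ road (LOC♭, COUNT♭, …) becomes available to the K3/K4 lines on
the theta habitat; the reverse inclusion (exact annihilator) additionally needs `E = E⁺ ⊕_{E(K_v)} E⁻` (files 11/14) and
functional separation, not done here.

## What is proved (any field `K`, any `p`, any `ℤ_p`-extension `κ`, any `K`-field `E` with `ι : K̄ → Ē`, any `W/K`;
## `g ∈ Γ_E` a local lift of the topological generator; `d` a Honda system of `a_p = 0` shape)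

* §1 `forall_evalOn_eq_zero_of_omega_dvd_pairingSum`: `ω_n ∣ P_{n,x}(z)` ⟹ `z(gʲx) = 0` for all `j < pⁿ` (Weierstrass uniqueness).
* §2 `exists_pow_smul_eq_smul`: every `τ ∈ Γ_{K_v}` acts on `E(K_n·K_v)` as a power `g^e`, `e < pⁿ`.
* §3 **`mem_colemanKer_flat_of_forall_plus`** (A): `z|_{E⁺_n} = 0 ∀n` ⟹ `z ∈ Ker Col♭` ((L), (TR) only).
* §4 **`apply_eq_zero_of_mem_colemanKer_flat_of_mem_plus`** (B): `z ∈ Ker Col♭` ⟹ `z|_{E⁺_n} = 0 ∀n` ((L), (TR), (GEN), (GEN₀),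
  (NT) no `p`-torsion in the tower, (IDX) layer degrees `p`); `mem_colemanKer_flat_iff_forall_plus`: the equivalence.

References: [Sprung2012] F. Sprung, J. Number Theory 132 (2012), Def. 3.1, Prop. 5.7, Def. 5.9, Def. 7.1–7.2, Def. 7.9, Open
Problem 7.22; [Kobayashi2003] S. Kobayashi, Invent. Math. 152 (2003), Def. 1.1, Prop. 8.12, Thm. 8.18–Prop. 8.23 (pp. 19–21);
[Sprung2017] Cor. 4.4 (`u_n, v_n` at `a_p = 0`); [Washington1997] §7.1 (distinguished polynomials, Weierstrass division).
-/

set_option autoImplicit false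
-- the Theorems namespace of this sub repeats the summit name by design (D-0017 nested layout)
set_option linter.dupNamespace false

noncomputable section

open scoped Classical

universe u

namespace Summit.BirchSwinnertonDyer.BirchSwinnertonDyer.Theorems

namespace SignedKatoOffTwo.FlatKernel

open Polynomial WeierstrassCurve Literature.NumberTheory.EllipticCurves Literature.NumberTheory.GaloisRepresentations
  Literature.NumberTheory.EllipticCurves.ZpExtension Literature.NumberTheory.EllipticCurves.Kobayashi2003
  Literature.NumberTheory.EllipticCurves.Sprung2017 Literature.NumberTheory.EllipticCurves.Sprung2012
  Summit.BirchSwinnertonDyer.Rank1Residual.Supersingular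

variable {K : Type u} [Field K] {p : ℕ} [hp : Fact p.Prime] (κ : ZpExtension K p)
variable {E : Type u} [Field E] [Algebra K E] (ι : AlgebraicClosure K →ₐ[K] AlgebraicClosure E)
variable (W : WeierstrassCurve K)

/-! ## §1 `ω_n ∣ P_{n,x}(z)` forces the pairing sum to vanish term by term (Weierstrass uniqueness) -/

/-- **If `ω_n` divides a pairing sum `P_{n,x}(z) = ∑_{j<pⁿ} z(gʲx)(1+T)ʲ` in `Λ = ℤ_p⟦T⟧`, then every value `z(gʲx)`,
`j < pⁿ`, vanishes.** `ω_n = (1+T)^{pⁿ} − 1` is a distinguished polynomial of degree `pⁿ`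
(`Kato2004.IwasawaH1Exists.isDistinguishedAt_omega`) and `P_{n,x}(z)` is (the image of) a polynomial of degree `< pⁿ`, so by the
uniqueness half of Weierstrass division (`PowerSeries.IsWeierstrassDivisorAt.eq_zero_of_mul_eq`) the polynomial is `0`; its
coefficients in the basis `(1+T)ʲ` are the `z(gʲx)`. [cite: Washington1997, §7.1 (Prop. 7.2)] [cite: Sprung2012, Def. 3.1 (p. 1489)] -/
theorem forall_evalOn_eq_zero_of_omega_dvd_pairingSum {A : AddSubgroup (localPoints W E)}
    {g : Field.absoluteGaloisGroup E} {n : ℕ} {x : localPoints W E} {z : A →+ ℤ_[p]}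
    (h : toIwasawa p (cyclotomicOmega p n) ∣ pairingSum W A g n x z) :
    ∀ j < p ^ n, evalOn W A z (g ^ j • x) = 0 := by
  -- the coefficient polynomial `r' = ∑ a_j X^j` and `r = r'(X + 1) = ∑ a_j (X+1)^j`
  set a : ℕ → ℤ_[p] := fun j => evalOn W A z (g ^ j • x) with ha
  set r' : ℤ_[p][X] := ∑ j ∈ Finset.range (p ^ n), C (a j) * X ^ j with hr'
  set r : ℤ_[p][X] := r'.comp (X + 1) with hr
  have hr_sum : r = ∑ j ∈ Finset.range (p ^ n), C (a j) * (X + 1) ^ j := by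
    rw [hr, hr', Polynomial.comp, eval₂_finsetSum]
    refine Finset.sum_congr rfl fun j _ => ?_
    rw [eval₂_mul, eval₂_C, eval₂_X_pow]
  -- `(r : Λ) = P_{n,x}(z)`
  have hcoe : (r : PowerSeries ℤ_[p]) = pairingSum W A g n x z := by
    rw [pairingSum_def, hr_sum, ← Polynomial.coeToPowerSeries.ringHom_apply, map_sum]
    refine Finset.sum_congr rfl fun j _ => ?_
    rw [Polynomial.coeToPowerSeries.ringHom_apply, Polynomial.coe_mul, Polynomial.coe_pow, Polynomial.coe_C,
      Polynomial.coe_add, Polynomial.coe_X, Polynomial.coe_one, add_comm PowerSeries.X 1]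
  -- `ω_n` as a distinguished polynomial over `ℤ_p`
  set ω : ℤ_[p][X] := (X + 1) ^ p ^ n - 1 with hω
  have hωI : toIwasawa p (cyclotomicOmega p n) = (ω : PowerSeries ℤ_[p]) := by
    change (((cyclotomicOmega p n).map (Int.castRingHom ℤ_[p]) : ℤ_[p][X]) : PowerSeries ℤ_[p]) = _
    rw [cyclotomicOmega, Polynomial.map_sub, Polynomial.map_pow, Polynomial.map_add, Polynomial.map_X,
      Polynomial.map_one]
  have hdist := Kato2004.IwasawaH1Exists.isDistinguishedAt_omega p n
  have hItop : IsLocalRing.maximalIdeal ℤ_[p] ≠ ⊤ := Ideal.IsPrime.ne_top inferInstance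
  have hdiv : (ω : PowerSeries ℤ_[p]).IsWeierstrassDivisorAt (IsLocalRing.maximalIdeal ℤ_[p]) :=
    hdist.isWeierstrassDivisorAt hItop
  -- the order of `ω_n mod p` is `pⁿ`
  have hpn : p ^ n ≠ 0 := pow_ne_zero n hp.out.ne_zero
  have hX1 : (X + 1 : ℤ_[p][X]).natDegree = 1 := by
    rw [← Polynomial.C_1, Polynomial.natDegree_X_add_C]
  have hpow : ((X + 1 : ℤ_[p][X]) ^ p ^ n).natDegree = p ^ n := by
    rw [natDegree_pow, hX1, mul_one]
  have hnat : ω.natDegree = p ^ n := by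
    rw [hω, natDegree_sub_eq_left_of_natDegree_lt, hpow]
    rw [hpow, natDegree_one]
    exact Nat.pos_of_ne_zero hpn
  have hord : ((ω : PowerSeries ℤ_[p]).map (Ideal.Quotient.mk (IsLocalRing.maximalIdeal ℤ_[p]))).order.toNat = p ^ n := by
    have h1 : PowerSeries.constantCoeff (1 : PowerSeries ℤ_[p]) ∉ IsLocalRing.maximalIdeal ℤ_[p] := by
      rw [map_one]; exact (Ideal.ne_top_iff_one _).mp hItop
    have h := hdist.coe_natDegree_eq_order_map (ω : PowerSeries ℤ_[p]) 1 h1 (by rw [mul_one])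
    rw [← h, ENat.toNat_coe, hnat]
  -- the degree of `r` is `< pⁿ`
  have hdeg' : r.natDegree < p ^ n := by
    have hle : r.natDegree ≤ p ^ n - 1 := by
      rw [hr_sum]
      refine natDegree_sum_le_of_forall_le _ _ fun j hj => ?_
      refine (natDegree_C_mul_le _ _).trans ((natDegree_pow_le).trans ?_)
      rw [hX1, mul_one]
      have := Finset.mem_range.mp hj
      omega
    have hpos : 0 < p ^ n := Nat.pos_of_ne_zero hpn
    omega
  have hdeg : r.degree < ((ω : PowerSeries ℤ_[p]).map (Ideal.Quotient.mk (IsLocalRing.maximalIdeal ℤ_[p]))).order.toNat := by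
    rw [hord]
    exact lt_of_le_of_lt Polynomial.degree_le_natDegree (by exact_mod_cast hdeg')
  -- Weierstrass uniqueness: `r = 0`
  obtain ⟨q, hq⟩ := h
  rw [hωI, ← hcoe] at hq
  have hr0 : r = 0 := (hdiv.eq_zero_of_mul_eq hdeg hq.symm).2
  -- hence `r' = 0` and all `a_j = 0`
  have hr'0 : r' = 0 := by
    have h0 : r'.comp (X + 1) = 0 := by rw [← hr]; exact hr0
    rcases (comp_eq_zero_iff.mp h0) with h | ⟨-, h⟩
    · exact h
    · exfalso
      have := congrArg natDegree h
      rw [hX1, natDegree_C] at this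
      exact one_ne_zero this
  intro j hj
  have hcoeff : r'.coeff j = a j := by
    rw [hr', finsetSum_coeff]
    simp_rw [coeff_C_mul_X_pow]
    rw [Finset.sum_ite_eq, if_pos (Finset.mem_range.mpr hj)]
  change a j = 0
  rw [← hcoeff, hr'0, coeff_zero]

/-! ## §2 Every `τ ∈ Γ_{K_v}` acts on the `n`-th layer as a power of the generator lift `g` -/

/-- For a local lift `g` of the topological generator (`κ(res g) = 1`): `κ(res gʲ) = j` (copy of the private helper of
`Sprung2012/LocalTowerTraceProofs`). [folklore] -/
private theorem kappa_resGalOfEmb_pow' {g : Field.absoluteGaloisGroup E}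
    (hg : κ.IsTopGenerator (resGalOfEmb ι g)) (j : ℕ) :
    (κ (resGalOfEmb ι (g ^ j))).toAdd = (j : ℤ_[p]) := by
  rw [map_pow]
  change (κ.toContinuousMonoidHom (resGalOfEmb ι g ^ j)).toAdd = _
  rw [map_pow, toAdd_pow]
  change j • (κ (resGalOfEmb ι g)).toAdd = _
  rw [hg, toAdd_ofAdd, nsmul_eq_mul, mul_one]

/-- **Every `τ ∈ Γ_{K_v}` is a power of `g` modulo `Gal(K̄_v/K_n·K_v)`**: `τ⁻¹ g^e ∈ Gal(K̄_v/K_n·K_v)` for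
`e = (κ(res τ) mod pⁿ).val < pⁿ` (copy of the private helper of `Sprung2012/LocalTowerTraceProofs`). [folklore] -/
private theorem inv_mul_pow_mem_localLayerSubgroupOfEmb' {g : Field.absoluteGaloisGroup E}
    (hg : κ.IsTopGenerator (resGalOfEmb ι g)) (n : ℕ) (τ : Field.absoluteGaloisGroup E) :
    τ⁻¹ * g ^ (PadicInt.toZModPow n (κ (resGalOfEmb ι τ)).toAdd).val ∈ localLayerSubgroupOfEmb κ ι n := by
  rw [mem_localLayerSubgroupOfEmb_iff, map_mul, map_inv]
  change (p : ℤ_[p]) ^ n ∣ (κ.toContinuousMonoidHom ((resGalOfEmb ι τ)⁻¹ * resGalOfEmb ι (g ^ _))).toAdd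
  rw [map_mul, map_inv, toAdd_mul, toAdd_inv]
  change (p : ℤ_[p]) ^ n ∣ -(κ (resGalOfEmb ι τ)).toAdd + (κ (resGalOfEmb ι (g ^ _))).toAdd
  rw [kappa_resGalOfEmb_pow' κ ι hg, ← Ideal.mem_span_singleton, ← PadicInt.ker_toZModPow,
    RingHom.mem_ker, map_add, map_neg, map_natCast, ZMod.natCast_zmod_val, neg_add_cancel]

/-- **The `Γ_{K_v}`-orbit of a point of `E(K_n·K_v)` consists of `g`-translates**: for `y ∈ E(K_n·K_v)` and any `τ ∈ Γ_{K_v}`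
there is `e < pⁿ` with `τ • y = g^e • y`. [cite: Kobayashi2003, Def. 1.1 (the layers K_n)] [cite: Sprung2012, §2 (p. 1486)] -/
theorem exists_pow_smul_eq_smul {g : Field.absoluteGaloisGroup E} (hg : κ.IsTopGenerator (resGalOfEmb ι g)) {n : ℕ}
    {y : localPoints W E} (hy : y ∈ localLayerPointsOfEmb κ ι W n) (τ : Field.absoluteGaloisGroup E) :
    ∃ e < p ^ n, τ • y = g ^ e • y := by
  haveI : NeZero (p ^ n) := ⟨pow_ne_zero _ hp.out.ne_zero⟩
  refine ⟨(PadicInt.toZModPow n (κ (resGalOfEmb ι τ)).toAdd).val, ZMod.val_lt _, ?_⟩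
  have h := (mem_localLayerPointsOfEmb_iff κ ι W n y).mp hy _ (inv_mul_pow_mem_localLayerSubgroupOfEmb' κ ι hg n τ)
  rw [mul_smul] at h
  -- `τ⁻¹ • (g^e • y) = y` ⟹ `g^e • y = τ • y`
  have h2 := congrArg (τ • ·) h
  simp only [smul_inv_smul] at h2
  exact h2.symm

/-! ## §3 (A) `Ann(E⁺_∞) ⊆ Ker Col♭` at `a_p = 0` -/

/-- The `a_p = 0` Honda relations in the `bsd-2adic` cell's currency: `Tr_{n+1/n} d_{n+1} = 0·d_n − d_{n−1}` for `n ≥ 1`,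
from `Tr_{m+2/m+1} d_{m+2} = −d_m` (the HONDA⁺@2 shape). [cite: Kobayashi2003, Lemma 8.9] [cite: Sprung2012, Thm. 2.2 (2′)] -/
theorem honda_trace_ap_zero {d : ℕ → localPoints W E}
    (htr : ∀ m, localTraceOfEmb κ ι W (m + 1) (m + 2) (d (m + 2)) = -d m) :
    ∀ n, 1 ≤ n → localTraceOfEmb κ ι W n (n + 1) (d (n + 1)) = (0 : ℤ) • d n - d (n - 1) := by
  intro n hn
  obtain ⟨m, rfl⟩ := Nat.exists_eq_add_of_le' hn
  rw [zero_smul, zero_sub, Nat.add_sub_cancel]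
  exact htr m

/-- **(A) A functional killing Kobayashi's plus groups lies in `Ker Col♭`, at `a_p = 0`.** For a Honda system `d` with (L)
`d_m ∈ E(K_m·K_v)`, (TR) `Tr_{m+2/m+1} d_{m+2} = −d_m`, a local lift `g` of the topological generator, and a functional `z` on
`E(K_∞·K_v)` with `z(x) = 0` for every `x ∈ E⁺(K_n·K_v)` and every `n`: `z ∈ Ker Col♭` (`colemanKer … 0 g d .flat`). Proof: `z`
has a Coleman value `(L♯, L♭)` (`SSFlatEC.exists_isColemanPair_of_trace`); at `a_p = 0` the even-level conditions read
`ω_n ∣ P_{n,d_n}(z) ± ω⁻_n L♭` and `P_{n,d_n}(z) = 0` there (`d_n ∈ E⁺_n` for even `n`, `Γ`-stable, killed by `z`), while the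
odd-level conditions do not involve `L♭` (`v_n = 0`); so `(L♯, 0)` is also a Coleman value of `z`.
[cite: Sprung2012, Def. 5.9 (p. 1495), Def. 7.1–7.2 and Def. 7.9 (pp. 1500–1503)] [cite: Kobayashi2003, Prop. 8.12 i), Thm. 8.18 (pp. 17–19)]
[cite: Sprung2017, Cor. 4.4] -/
theorem mem_colemanKer_flat_of_forall_plus {g : Field.absoluteGaloisGroup E}
    (hg : κ.IsTopGenerator (resGalOfEmb ι g)) {d : ℕ → localPoints W E}
    (hd : ∀ m, d m ∈ localLayerPointsOfEmb κ ι W m)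
    (htr : ∀ m, localTraceOfEmb κ ι W (m + 1) (m + 2) (d (m + 2)) = -d m)
    (z : localTowerPointsOfEmb κ ι W →+ ℤ_[p])
    (hz : ∀ (n : ℕ) (x : localTowerPointsOfEmb κ ι W),
      (x : localPoints W E) ∈ signedLocalPointsOfEmb κ ι W 1 n → z x = 0) :
    z ∈ colemanKer κ ι W 0 g d .flat := by
  obtain ⟨Ls, Lf, hCP⟩ :=
    SSFlatEC.exists_isColemanPair_of_trace κ ι W hg (dvd_zero _) hd (honda_trace_ap_zero κ ι W htr) z
  refine ⟨Ls, 0, fun n => ?_, by rw [chromaticL_flat]⟩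
  rcases Nat.even_or_odd n with hn | hn
  · -- even level: the pairing sum vanishes identically
    have hsum : pairingSum W (localTowerPointsOfEmb κ ι W) g n (d n) z = 0 := by
      rw [pairingSum_def]
      refine Finset.sum_eq_zero fun j _ => ?_
      have hdn : d n ∈ signedLocalPointsOfEmb κ ι W 1 n := by
        obtain ⟨k, hk⟩ := hn
        rw [hk, ← two_mul]
        exact SignedEC.d_even_mem_signedLocalPointsOfEmb_one W κ ι d hd htr k
      have hmem : g ^ j • d n ∈ signedLocalPointsOfEmb κ ι W 1 n :=
        SignedEC.closure_orbit_le_signedLocalPointsOfEmb W κ ι 1 n hdn (AddSubgroup.subset_closure ⟨g ^ j, rfl⟩)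
      have hT : g ^ j • d n ∈ localTowerPointsOfEmb κ ι W :=
        localLayerPointsOfEmb_le_localTowerPointsOfEmb κ ι W n (signedLocalPointsOfEmb_le κ ι W 1 n hmem)
      rw [evalOn_of_mem W _ z hT, hz n ⟨_, hT⟩ hmem, map_zero, zero_mul]
    rw [hsum, sharpPoly_zero_of_even p hn]
    simp only [map_zero, zero_mul, mul_zero, add_zero]
    exact dvd_zero _
  · -- odd level: `v_n = 0`, the condition is that of `(L♯, L♭)`
    have h := hCP n
    simp only [flatPoly_zero_of_odd p hn, map_zero, zero_mul, add_zero] at h ⊢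
    exact h

/-! ## §4 (B) `Ker Col♭ ⊆ Ann(E⁺_∞)` at `a_p = 0`, and the equality -/

/-- **(B) A functional in `Ker Col♭` kills every plus group `E⁺(K_n·K_v)`, at `a_p = 0`.** Hypotheses: (NT) no `p`-torsion in
`E(K_∞·K_v)`, (IDX) local layer degrees `p`, a Honda system `d` with (L), (TR) (`a_p = 0` shape), (GEN), (GEN₀) — the clauses of
K4's `stub_plusHondaSystemTwo` — and a local lift `g` of the topological generator. Proof: `Col♭(z) = 0` and `u_n = 0` (even `n`)
give `ω_n ∣ P_{n,d_n}(z)`, so `z(gʲ d_n) = 0` for `j < pⁿ` (§1), so `z` kills the `Γ_{K_v}`-orbit of `d_n` (§2) and its span;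
CYC⁺ (`SignedEC.plusCyclic_even_of_honda`: `E⁺_n = ℤ[Γ]·d_n + p·E⁺_n`, even `n`) then gives `z(E⁺_n) ⊆ p^k ℤ_p` for every `k`,
hence `z(E⁺_n) = 0`; odd `n` reduce to even (`E⁺_{2j+1} ≤ E⁺_{2j}`). [cite: Kobayashi2003, Prop. 8.12, Thm. 8.18–Prop. 8.23 (pp. 17–21)]
[cite: Sprung2012, Def. 5.9, Def. 7.1, Def. 7.9 (pp. 1495–1503)] [cite: Sprung2017, Cor. 4.4] -/
theorem apply_eq_zero_of_mem_colemanKer_flat_of_mem_plus {g : Field.absoluteGaloisGroup E}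
    (hg : κ.IsTopGenerator (resGalOfEmb ι g))
    (hnt : ∀ P ∈ localTowerPointsOfEmb κ ι W, p • P = 0 → P = 0)
    (hidx : ∀ m : ℕ, ((localLayerSubgroupOfEmb κ ι (m + 1)).subgroupOf (localLayerSubgroupOfEmb κ ι m)).index = p)
    {d : ℕ → localPoints W E} (hd : ∀ m, d m ∈ localLayerPointsOfEmb κ ι W m)
    (htr : ∀ m, localTraceOfEmb κ ι W (m + 1) (m + 2) (d (m + 2)) = -d m)
    (hgen : ∀ m : ℕ, 1 ≤ m → ∀ P ∈ localLayerPointsOfEmb κ ι W m,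
      ∃ B ∈ AddSubgroup.closure (Set.range fun σ : Field.absoluteGaloisGroup E ↦ σ • d m),
        ∃ P' ∈ localLayerPointsOfEmb κ ι W (m - 1), ∃ R ∈ localLayerPointsOfEmb κ ι W m, P = B + P' + p • R)
    (hgen0 : ∀ P ∈ localLayerPointsOfEmb κ ι W 0, ∃ a : ℤ, ∃ R ∈ localLayerPointsOfEmb κ ι W 0, P = a • d 0 + p • R)
    {z : localTowerPointsOfEmb κ ι W →+ ℤ_[p]} (hz : z ∈ colemanKer κ ι W 0 g d .flat)
    (n : ℕ) (x : localTowerPointsOfEmb κ ι W) (hx : (x : localPoints W E) ∈ signedLocalPointsOfEmb κ ι W 1 n) :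
    z x = 0 := by
  -- reduce to even layers
  suffices key : ∀ (j : ℕ) (y : localTowerPointsOfEmb κ ι W),
      (y : localPoints W E) ∈ signedLocalPointsOfEmb κ ι W 1 (2 * j) → z y = 0 by
    rcases Nat.even_or_odd n with ⟨j, hj⟩ | ⟨j, hj⟩
    · refine key j x ?_
      rw [two_mul, ← hj]; exact hx
    · subst hj
      exact key j x (SignedEC.signedLocalPointsOfEmb_one_odd_le W κ ι hnt j hx)
  intro j
  -- Step 1: `ω_{2j} ∣ P_{2j, d_{2j}}(z)` from `Col♭(z) = 0` and `u_{2j} = 0`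
  obtain ⟨Ls, Lf, hCP, hLf⟩ := hz
  rw [chromaticL_flat] at hLf
  subst hLf
  have hdvd : toIwasawa p (cyclotomicOmega p (2 * j)) ∣
      pairingSum W (localTowerPointsOfEmb κ ι W) g (2 * j) (d (2 * j)) z := by
    have h := hCP (2 * j)
    simp only [sharpPoly_zero_of_even p (even_two_mul j), map_zero, zero_mul, mul_zero, add_zero] at h
    exact h
  -- Step 2: `z` vanishes on the `g`-orbit, hence on the `Γ`-orbit span of `d_{2j}`
  have horb0 := forall_evalOn_eq_zero_of_omega_dvd_pairingSum W hdvd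
  have hspan : AddSubgroup.closure (Set.range fun σ : Field.absoluteGaloisGroup E ↦ σ • d (2 * j)) ≤
      (AddMonoidHom.ker z).map (localTowerPointsOfEmb κ ι W).subtype := by
    rw [AddSubgroup.closure_le]
    rintro _ ⟨σ, rfl⟩
    obtain ⟨e, he, heq⟩ := exists_pow_smul_eq_smul κ ι W hg (hd (2 * j)) σ
    have hT : g ^ e • d (2 * j) ∈ localTowerPointsOfEmb κ ι W :=
      smul_mem_localTowerPointsOfEmb κ ι W _ (localLayerPointsOfEmb_le_localTowerPointsOfEmb κ ι W _ (hd _))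
    refine ⟨⟨g ^ e • d (2 * j), hT⟩, ?_, heq.symm⟩
    rw [SetLike.mem_coe, AddMonoidHom.mem_ker]
    have h0 := horb0 e he
    rwa [evalOn_of_mem W _ z hT] at h0
  have hkill : ∀ B ∈ AddSubgroup.closure (Set.range fun σ : Field.absoluteGaloisGroup E ↦ σ • d (2 * j)),
      ∀ hB : B ∈ localTowerPointsOfEmb κ ι W, z ⟨B, hB⟩ = 0 := by
    intro B hB hBT
    obtain ⟨t, ht, htB⟩ := hspan hB
    have : (⟨B, hBT⟩ : localTowerPointsOfEmb κ ι W) = t := Subtype.ext htB.symm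
    rw [this]
    exact ht
  -- Step 3: CYC⁺ ⟹ `z(E⁺_{2j}) ⊆ p^k ℤ_p` for every `k`
  have hcyc := SignedEC.plusCyclic_even_of_honda W κ ι hnt hidx d hd htr hgen hgen0 j
  have hind : ∀ (k : ℕ) (y : localTowerPointsOfEmb κ ι W),
      (y : localPoints W E) ∈ signedLocalPointsOfEmb κ ι W 1 (2 * j) → (p : ℤ_[p]) ^ k ∣ z y := by
    intro k
    induction k with
    | zero => intro y _; rw [pow_zero]; exact one_dvd _
    | succ k ih =>
      intro y hy
      obtain ⟨B, hB, b, hb, hyB⟩ := hcyc y hy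
      have hbT : b ∈ localTowerPointsOfEmb κ ι W :=
        localLayerPointsOfEmb_le_localTowerPointsOfEmb κ ι W _ (signedLocalPointsOfEmb_le κ ι W 1 _ hb)
      have hBT : B ∈ localTowerPointsOfEmb κ ι W := by
        have h : B = (y : localPoints W E) - p • b := eq_sub_of_add_eq hyB.symm
        rw [h]
        exact sub_mem y.2 (AddSubgroup.nsmul_mem _ hbT _)
      have hysum : y = ⟨B, hBT⟩ + p • ⟨b, hbT⟩ := Subtype.ext (by simpa using hyB)
      rw [hysum, map_add, map_nsmul, hkill B hB hBT, zero_add, nsmul_eq_mul, pow_succ']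
      exact mul_dvd_mul_left _ (ih ⟨b, hbT⟩ hb)
  -- Step 4: `p`-adic separation
  intro y hy
  exact SSFlatEC.padicInt_eq_zero_of_forall_pow_dvd (fun k => hind k y hy)

/-- **`Ker Col♭ = Ann(E⁺_∞)` at `a_p = 0`** — the two directions combined: for a functional `z` on `E(K_∞·K_v)`,
`z ∈ Ker Col♭ ↔ ∀ n, z|_{E⁺(K_n·K_v)} = 0`. At `p = 2` on the theta habitat (`a₂ = 0`) this identifies Sprung's ♭ Coleman kernel
(the `bsd-2adic` cell's machinery) with the annihilator of Kobayashi's plus groups, the local condition of K3's `Sel⁺(E/ℚ_∞)`.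
[cite: Kobayashi2003, Thm. 8.18–Prop. 8.23 (pp. 19–21)] [cite: Sprung2012, Def. 7.9 and Open Problem 7.22 (pp. 1503–1505)] -/
theorem mem_colemanKer_flat_iff_forall_plus {g : Field.absoluteGaloisGroup E}
    (hg : κ.IsTopGenerator (resGalOfEmb ι g))
    (hnt : ∀ P ∈ localTowerPointsOfEmb κ ι W, p • P = 0 → P = 0)
    (hidx : ∀ m : ℕ, ((localLayerSubgroupOfEmb κ ι (m + 1)).subgroupOf (localLayerSubgroupOfEmb κ ι m)).index = p)
    {d : ℕ → localPoints W E} (hd : ∀ m, d m ∈ localLayerPointsOfEmb κ ι W m)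
    (htr : ∀ m, localTraceOfEmb κ ι W (m + 1) (m + 2) (d (m + 2)) = -d m)
    (hgen : ∀ m : ℕ, 1 ≤ m → ∀ P ∈ localLayerPointsOfEmb κ ι W m,
      ∃ B ∈ AddSubgroup.closure (Set.range fun σ : Field.absoluteGaloisGroup E ↦ σ • d m),
        ∃ P' ∈ localLayerPointsOfEmb κ ι W (m - 1), ∃ R ∈ localLayerPointsOfEmb κ ι W m, P = B + P' + p • R)
    (hgen0 : ∀ P ∈ localLayerPointsOfEmb κ ι W 0, ∃ a : ℤ, ∃ R ∈ localLayerPointsOfEmb κ ι W 0, P = a • d 0 + p • R)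
    (z : localTowerPointsOfEmb κ ι W →+ ℤ_[p]) :
    z ∈ colemanKer κ ι W 0 g d .flat ↔
      ∀ (n : ℕ) (x : localTowerPointsOfEmb κ ι W),
        (x : localPoints W E) ∈ signedLocalPointsOfEmb κ ι W 1 n → z x = 0 :=
  ⟨fun hz n x hx => apply_eq_zero_of_mem_colemanKer_flat_of_mem_plus κ ι W hg hnt hidx hd htr hgen hgen0 hz n x hx,
    fun hz => mem_colemanKer_flat_of_forall_plus κ ι W hg hd htr z hz⟩

end SignedKatoOffTwo.FlatKernel

end Summit.BirchSwinnertonDyer.BirchSwinnertonDyer.Theorems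

end
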